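import Summits.AtomisticToContinuum.HydrodynamicLimit.Theses.ImplosionDichotomy
import Literature.MathematicalPhysics.KineticTheory.HardSphereEulerLLN

/-!
# Line `eos-defect-as-forcing` — crux `ImplosionDichotomy.PolynomialCompression` (stmt-AtomisticToContinuum-12587)

Crux-plan skeleton (planner-cruxplan-stmt-AtomisticToContinuum-12587-eos-defect-as-forcin-0, 2026-08-15).
Line card: `Lines/eos-defect-as-forcing.md`. Idea card: `Ideas/eos-defect-as-forcing.md`.

THESIS OF THE LINE. Put the hard-sphere equation-of-state defect `Z(ρσ³) − 1 = (2π/3)ρσ³ + …` (and the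
`O(σ³)` entropy defect of the local-Gibbs datum) into the FORCING SLOT `𝓕_dis` of the Cao-Labora–Gómez-Serrano–
Shi–Staffilani self-similar stability scheme (arXiv:2310.05325; their Prop. 3.3 is CONDITIONAL on the size
`‖P_uns‖_X ≤ δ₁` of the unstable projection, its proof uses the bound and not the tuning), and run that bootstrap
UNTUNED on the finite horizon on which the unstable projection of (σ-solution − exact profile), which starts at
`O(σ³)` and grows at most like `e^{Λ' s}` (`Λ'` = growth bound of the cut-off linearised semigroup on the
finite-dimensional `V_uns`, maximised with the forcing rate `g = 3(r−1)`), is still `≤ δ₁`. At the exit time,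
`T − t_e ≍ σ^{3r/Λ'}`, the solution is still `S̄(0)/2`-close to the profile in the self-similar sound-speed variable,
hence `ρ(t_e, x⋆) ≥ (S̄(0)/6r)³ (T−t_e)^{−β} ≥ σ^{−κ₀}`, `β = 3(1−1/r)`, any `κ₀ < 3g/Λ'` (`= 3β` when the top
rate is the gauge rate `r`, Biasi 2021 numerics — payoff only; ANY finite rate gives `κ₀ > 0`).

OBLIGATIONS. Four registered stubs + the route's support item `HsEosLowDensity` (stmt-0768) BY NAME:
* `stub_selfSimilarProfile : SelfSimilarProfile` — known (BCG arXiv:2208.09445 Thm 1.1 at γ = 5/3; CGSS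
  (1.5)–(1.10) and Lemma 4.1); size L.
* `stub_localWellPosedness : LocalWellPosedness` — known in print, un-vendored (Kato 1975 / Majda 1984
  Thm 2.1–2.2): `HsEosLowDensity → LWP`; size L.
* `stub_forcedFiniteHorizonBootstrap : ForcedFiniteHorizonBootstrap` — THE load-bearing stub (new); size XL.
* `stub_smoothLocalGibbsStatics : SmoothLocalGibbsStatics` — statics with identified LLN density and `C^m`
  rate `σ³` (tree: `rhoLim`, `abs_clusterCoeff_le`, `localGibbs_lln_holds`); size M.
* `uniform_of_stubs` (proved): the stubs give the σ-UNIFORM compression `PolynomialCompressionUniform` (C⁺).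
* `uniform_of_stubs` is stated with the five hypotheses EXPLICIT:
  `HsEosLowDensity → SelfSimilarProfile → LocalWellPosedness → ForcedFiniteHorizonBootstrap → SmoothLocalGibbsStatics → C⁺`.
* `PolynomialCompression_of (hEos : HsEosLowDensity) : ImplosionDichotomy.PolynomialCompression` (its own proof has no sorry):
  the composition concluding the crux BY NAME from the four `stub_*` theorems and the route item `HsEosLowDensity` (the only
  hypothesis; admissible by name). When the four stubs are proved this file is the proof of `HsEosLowDensity → crux`.

DISPROOF USED (standing `Cruxes/PolynomialCompression/Disproof.lean`, cdisprove cycles 1–2, read 2026-08-15T23:4xZ;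
verdict RESISTS, no `_false_without_` theorem, no landed `Theorems/PolynomialCompression/Negative/` lemma):
§1 `admissible_congr_zero` / `tiedThrough_iff_tied` (the tie sees only time-0 slices, flow-independent) — mirrored by
the proved `tendstoHydroFieldsAt_zero_congr`, one LLN family gives the `∀Φ` clause; §2–§3 `lln_rhoLim`,
`densityLLN_rhoLim`, `data_eq_of_tied`, `admissible_iff_data`, `abs_rhoLim_sub_β_le`, `integral_rhoLim_eq_one` —
the datum of every admissible solution IS `rhoLim (profileOf a₀) σ`: `stub_smoothLocalGibbsStatics` is stated for
exactly that density (its LLN and `k = 0` rate are the Disproof's theorems; smoothness + `C^m` rate remain); §4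
`polynomialCompression_iff_pde` — the composition here is an instance of the PDE form (pinned data family, glued
implosion profiles); §7 `polynomialCompressionUntied_holds` (the tie is load-bearing: kept) and
`not_polynomialCompressionAtTimeZero` (no compression at `t = 0`: here compression happens at `t_e(σ) → T`, clause
(ii) of `ShadowsUntilCompression` fails at `t = 0` for small σ since the datum is the fixed glued profile); §8
`shadowing_exponent` / `mechanism_audit` inputs: I1 ↦ `stub_selfSimilarProfile` (+ glued data inside stub 3),
I2 ↦ `stub_smoothLocalGibbsStatics` (q = 3), I3 ↦ the hypothesis `HsEosLowDensity`, I4 ↦ `stub_localWellPosedness`,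
I5 ↦ `stub_forcedFiniteHorizonBootstrap` (C = Λ′/r named, spectral instead of energy constant).
-/

noncomputable section

open scoped ContDiff
open MeasureTheory Set
open Literature.MathematicalPhysics.KineticTheory
open Literature.Analysis.FunctionSpaces
open Literature.Analysis.FluidPDE (HardSphereFlow)
open Summit.AtomisticToContinuum.HydrodynamicLimit.Theses.ImplosionDichotomy (PolynomialCompression HsEosLowDensity)

namespace Summit.AtomisticToContinuum.HydrodynamicLimit.Cruxes.PolynomialCompression.EosDefectAsForcing

/-- Euclidean `ℝ³` (self-similar space variable `y`; tangent vectors of `𝕋³` via `Torus.proj`). -/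
abbrev E3 : Type := EuclideanSpace ℝ (Fin 3)

/-! ## Objects of the line (explicit formulas; no new axioms, no new types) -/

/-- Upper end of the Cao-Labora–Gómez-Serrano–Shi–Staffilani range (1.10) at `γ = 5/3`:
`r⋆ = (3γ−1)/(2+√3(γ−1)) = 4/(2 + 2√3/3) ≈ 1.268`. -/
def rStar : ℝ := 4 / (2 + 2 * Real.sqrt 3 / 3)

/-- The radial vector field `Ū(y) = U(|y|) y/|y|` on `ℝ³` (value `0` at `y = 0`). -/
def radialField (U : ℝ → ℝ) (y : E3) : E3 := (U ‖y‖ / ‖y‖) • y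

/-- The radial scalar field `S̄(y) = S(|y|)` on `ℝ³`. -/
def radialScalar (S : ℝ → ℝ) (y : E3) : ℝ := S ‖y‖

/-- **Admissible self-similar implosion profile of the monatomic gas** (`γ = 5/3`, `α = (γ−1)/2 = 1/3`): exactly
the hypotheses of CGSS arXiv:2310.05325 Thm 1.2 / Rem 1.5 — eqs. (1.5)–(1.10) — on a radial pair
`(Ū, S̄) = (U(R)ŷ, S(R))`, `R = |y|` (CGSS Lemma 4.1: `U = Ū/R·R`, i.e. `Ū_R = U`):
(range 1.10) `1 < r < r⋆(5/3)`; (smooth) the 3-D fields `y ↦ U(|y|)y/|y|`, `y ↦ S(|y|)` are `C^∞(ℝ³)`;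
(1.5, radial form) `(r−1)U + (R+U)U′ + αSS′ = 0` and `(r−1)S + (R+U)S′ + αS(U′ + 2U/R) = 0` for `R > 0`
(from `(y+Ū)·∇Ū = (R+U)U′ŷ`, `div Ū = U′ + 2U/R`); (1.6) `S > 0`, `|∇ʲŪ| + |∇ʲS̄| ≲_j ⟨R⟩^{−(r−1)−j}` for
every `j`, `S ≳ ⟨R⟩^{−(r−1)}`; (1.7) radial repulsivity `1 + U′ − α|S′| > η̃` and (1.8) angular repulsivity
`1 + U/R − α|S′| > η̃` for one `η̃ > 0`. BCG arXiv:2208.09445 Thm 1.1 gives such a profile for `γ = 5/3`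
(`r = r⁽³⁾(5/3) ∈ (r₃, r₄)`; CGSS p. 6: "in the regime (1.10) for all γ > 1, including γ = 5/3"). -/
def AdmissibleProfile (r : ℝ) (U S : ℝ → ℝ) : Prop :=
  -- (1.10) range of the self-similar parameter
  (1 < r ∧ r < rStar) ∧
  -- smoothness of the 3-D profile fields on ℝ³
  ContDiff ℝ ∞ (radialField U) ∧ ContDiff ℝ ∞ (radialScalar S) ∧
  -- (1.5) the profile ODE, radial form, α = 1/3
  (∀ R : ℝ, 0 < R → (r - 1) * U R + (R + U R) * deriv U R + (1 / 3 : ℝ) * S R * deriv S R = 0) ∧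
  (∀ R : ℝ, 0 < R →
    (r - 1) * S R + (R + U R) * deriv S R + (1 / 3 : ℝ) * S R * (deriv U R + 2 * U R / R) = 0) ∧
  -- (1.6) positivity, decay of all derivatives, lower bound
  (∀ R : ℝ, 0 ≤ R → 0 < S R) ∧
  (∀ j : ℕ, ∃ C : ℝ, ∀ y : E3,
    ‖iteratedFDeriv ℝ j (radialField U) y‖ + ‖iteratedFDeriv ℝ j (radialScalar S) y‖ ≤
      C * (1 + ‖y‖) ^ (-(r - 1) - (j : ℝ))) ∧
  (∃ c : ℝ, 0 < c ∧ ∀ R : ℝ, 0 ≤ R → c * (1 + R) ^ (-(r - 1)) ≤ S R) ∧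
  -- (1.7) radial and (1.8) angular repulsivity
  (∃ η : ℝ, 0 < η ∧ ∀ R : ℝ, 0 < R →
    η < 1 + deriv U R - (1 / 3 : ℝ) * |deriv S R| ∧ η < 1 + U R / R - (1 / 3 : ℝ) * |deriv S R|)

/-- Exact self-similar DENSITY of the profile at physical distance `R` from the centre and time `t < T`
(CGSS (1.2) with `ρ = (ασ)^{1/α} = (σ/3)³`, `σ = 3ρ^{1/3}` the rescaled sound speed, `α = 1/3`):
`ρ(x,t) = ((T−t)^{1/r−1} S(R/(T−t)^{1/r}) / (3r))³`; at the centre `(S(0)/3r)³ (T−t)^{−β}`, `β = 3(1−1/r)`. -/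
def ssDensity (r : ℝ) (S : ℝ → ℝ) (T t R : ℝ) : ℝ :=
  ((T - t) ^ (1 / r - 1) * S (R / (T - t) ^ (1 / r)) / (3 * r)) ^ 3

/-- Exact self-similar VELOCITY of the profile at the tangent vector `v` from the centre and time `t < T`:
`u(x,t) = ((T−t)^{1/r−1}/r) Ū(v/(T−t)^{1/r}) = ((T−t)^{1/r−1}/r) (U(|v|/(T−t)^{1/r})/|v|) v`. -/
def ssVelocity (r : ℝ) (U : ℝ → ℝ) (T t : ℝ) (v : E3) : E3 :=
  ((T - t) ^ (1 / r - 1) / r * (U (‖v‖ / (T - t) ^ (1 / r)) / ‖v‖)) • v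

/-! ## Stub statements -/

/-- STUB 1 (known; size L — BCG phase portrait through the sonic point `P_s` with the `ν₋` branch, focus-point
decay, CGSS Lemma 4.1): an admissible `γ = 5/3` profile exists. -/
def SelfSimilarProfile : Prop :=
  ∃ (r : ℝ) (U S : ℝ → ℝ), AdmissibleProfile r U S

/-- Local well-posedness package for classical hard-sphere Euler `IsHardSphereEulerSolution σ` at packing below
`η₁` (symmetric-hyperbolic: `p = ρθZ(ρσ³)`, `e = 3θ/2`, `c² = θ[(Z+ηZ′) + (2/3)Z²] > 0`, `Z` analytic on
`(0, η₁)`): (a) smooth positive data with packing `< η₁` launch a classical solution on some `[0,T)`, `T > 0`;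
(b) C¹-continuation: a classical solution on `[0,T)` with fields and first space derivatives bounded by `B`,
`ρ, θ ≥ 1/B` and packing `≤ η₁ − 1/B`, extends to a classical solution on some `[0,T')`, `T' > T`, agreeing on
`[0,T)`. Kato 1975 (ARMA 58) / Majda 1984 Thm 2.1–2.2 / Dafermos 2005 Thm 5.1.1, all Sobolev orders with a
common lifespan, transcribed into the torus calculus (`Torus.timeDerivWithin`, joint `C^∞`). -/
def LWP : Prop :=
  ∃ η₁ : ℝ, 0 < η₁ ∧ ∀ σ : ℝ, 0 < σ →
    (∀ (ρ₀ θ₀ : T3 → ℝ) (u₀ : T3 → V3), Torus.IsSmooth ρ₀ → Torus.IsSmooth u₀ → Torus.IsSmooth θ₀ →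
        (∀ x, 0 < ρ₀ x) → (∀ x, 0 < θ₀ x) → (∀ x, ρ₀ x * σ ^ 3 < η₁) →
        ∃ T : ℝ, 0 < T ∧ ∃ (ρ θ : ℝ → T3 → ℝ) (u : ℝ → T3 → V3),
          IsHardSphereEulerSolution σ T ρ u θ ∧ ρ 0 = ρ₀ ∧ u 0 = u₀ ∧ θ 0 = θ₀) ∧
    (∀ (T : ℝ) (ρ θ : ℝ → T3 → ℝ) (u : ℝ → T3 → V3), 0 < T → IsHardSphereEulerSolution σ T ρ u θ →
        (∃ B : ℝ, ∀ t ∈ Ico 0 T, ∀ x, B⁻¹ ≤ ρ t x ∧ B⁻¹ ≤ θ t x ∧ ρ t x * σ ^ 3 ≤ η₁ - B⁻¹ ∧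
            |ρ t x| + ‖u t x‖ + |θ t x| + ‖Torus.fderiv (ρ t) x‖ + ‖Torus.fderiv (u t) x‖ +
              ‖Torus.fderiv (θ t) x‖ ≤ B) →
        ∃ T' : ℝ, T < T' ∧ ∃ (ρ' θ' : ℝ → T3 → ℝ) (u' : ℝ → T3 → V3),
          IsHardSphereEulerSolution σ T' ρ' u' θ' ∧ ∀ t ∈ Ico 0 T, ρ' t = ρ t ∧ u' t = u t ∧ θ' t = θ t)

/-- STUB 2 (known in print, un-vendored; size L): the hard-sphere equation of state analytic at low density
(`HsEosLowDensity`, route support stmt-0768, makes `hsCompressibility` analytic on `(0, η₀)`) gives `LWP`. -/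
def LocalWellPosedness : Prop :=
  HsEosLowDensity → LWP

/-- What the forced finite-horizon bootstrap delivers for ONE admissible profile `(r, U, S)` — the σ-family
SHADOWS THE IMPLOSION UNTIL POLYNOMIAL COMPRESSION: there are smooth unit-mass reference data
`(ρ̄₀, u₀, θ₀ := (3/5)ρ̄₀^{2/3})` on `𝕋³` (isentropic for the monatomic ideal gas with CGSS's normalisation
`p = ρ^{5/3}/γ`) which COINCIDE WITH THE EXACT SELF-SIMILAR PROFILE DATA of blow-up time `T` and centre `x⋆` on
the ball of radius `ϱ` (glued profile: `a_i = 0`, `χ₂Ũ₀' = 0 ∈ V_sta`; outside the ball any smooth positive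
continuation, e.g. CGSS's floor `(δ₁/2)⟨R/R₀⟩^{1−r}`), an order `m` and ONE exponent `κ₀ > 0`, such that for every
defect constant `M`, all small `σ` and EVERY smooth positive datum `ρ₀` that is `Mσ³`-close to `ρ̄₀` in `C^m`
(all derivatives of the periodic lift up to order `m`), the hard-sphere system of reduced diameter `σ` with data
`(ρ₀, u₀, θ₀)` has a classical solution which (i) stays `S(0)/2`-close to the profile in the self-similar
sound-speed variable `3r(T−t)^{1−1/r}ρ^{1/3}` on the inner half-ball up to some time `t < T`, and (ii) has
density `≥ σ^{−κ₀}` at the centre at that time. -/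
def ShadowsUntilCompression (r : ℝ) (U S : ℝ → ℝ) : Prop :=
  ∃ (ρb : T3 → ℝ) (u₀ : T3 → V3) (xc : T3) (T ϱ : ℝ) (m : ℕ) (κ₀ : ℝ),
    0 < T ∧ 0 < ϱ ∧ 0 < κ₀ ∧ Torus.IsSmooth ρb ∧ Torus.IsSmooth u₀ ∧ (∀ x, 0 < ρb x) ∧
    ∫ x, ρb x = 1 ∧
    (∀ v : E3, ‖v‖ < ϱ →
      ρb (xc + Torus.proj v) = ssDensity r S T 0 ‖v‖ ∧ u₀ (xc + Torus.proj v) = ssVelocity r U T 0 v) ∧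
    ∀ M : ℝ, 0 < M → ∃ σ₁ : ℝ, 0 < σ₁ ∧ ∀ σ : ℝ, 0 < σ → σ < σ₁ →
      ∀ ρ₀ : T3 → ℝ, Torus.IsSmooth ρ₀ → (∀ x, 0 < ρ₀ x) →
        (∀ k : ℕ, k ≤ m → ∀ y : E3,
          ‖iteratedFDeriv ℝ k (Torus.lift (fun x => ρ₀ x - ρb x)) y‖ ≤ M * σ ^ 3) →
        ∃ (Te : ℝ) (ρ θ : ℝ → T3 → ℝ) (u : ℝ → T3 → V3),
          IsHardSphereEulerSolution σ Te ρ u θ ∧ ρ 0 = ρ₀ ∧ u 0 = u₀ ∧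
          (θ 0 = fun x => 3 / 5 * ρb x ^ (2 / 3 : ℝ)) ∧
          ∃ t ∈ Ico 0 Te, t < T ∧
            (∀ t' ∈ Icc 0 t, ∀ v : E3, ‖v‖ < ϱ / 2 →
              |3 * r * (T - t') ^ (1 - 1 / r) * (ρ t' (xc + Torus.proj v)) ^ (1 / 3 : ℝ) -
                  S (‖v‖ / (T - t') ^ (1 / r))| ≤ S 0 / 2) ∧
            σ ^ (-κ₀) ≤ ρ t xc

/-- STUB 3 — THE LOAD-BEARING STUB (new; size XL): **forced finite-horizon self-similar bootstrap.** Given the EOS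
analytic at small packing and the well-posedness package, EVERY admissible profile is shadowed until polynomial
compression. Intended proof = CGSS arXiv:2310.05325 re-run for the full 5×5 hard-sphere system around the
isentropic profile: §2 / Prop 1.8 verbatim (the linearised operator of the σ-problem's isentropic part IS CGSS's
cut-off operator `𝓛 = χ₂𝓛^e − J(1−χ₁)` on `X`, `X = V_sta ⊕ V_uns`, decay `e^{−sδ_g/2}` on `V_sta`, `V_uns`
finite-dimensional, growth `≤ e^{Λ s}` on it; the `O(σ³)` entropy perturbation is transported along `y + U`,
dissipative in `Ḣ^m` for `m > 3/2`, and feeds `(Ũ,S̃)` only as forcing); §3.1 Lemma 3.1 (truncated = extended on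
`B(0,C₀)`), §3.2 data conditions (3.8)–(3.9) met by the glued profile with `a_i = 0` — by finite speed of
propagation the `σ = 0` solution IS the profile on `supp χ₂` for all `s`, so NO Brouwer tuning (Props 3.14–3.15
unused); §3.2–3.4 Prop 3.3 with its hypothesis `‖P_uns‖_X ≤ δ₁e^{−ε(s−s₀)}` and conclusions
`|Ũ|,|S̃| ≤ δ₀e^{−ε(s−s₀)}/C₂`, `Ḣ⁴(|y| ≥ C₀) ≤ δ₀e^{−ε(s−s₀)}`, `E_K ≤ E` replaced by NON-DECAYING sup-bounds on
the finite horizon `[s₀, s_e]`, the forcing slot `‖χ₂𝓕‖_X ≲ δ₁^{6/5}` (eq. before Prop 3.14) now also carrying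
`𝓕_eos = −α[(c_σ²/c₀²)(ρ) − 1]S∇S + transported-entropy terms` of relative size `(2π/3)ρσ³ = O(σ³(S/3r)³e^{gs})`,
`g = 3(r−1)` (m derivatives of `Z` at packing `≤ η₀` from `HsEosLowDensity` — exactly the horizon); the unstable
projection of (σ-solution − profile) obeys `k′ = 𝓛|_{V_uns}k + O(δ₀)k + O(σ³e^{gs})`, `k(s₀) = O(Mσ³)`, so
`‖k(s)‖ ≲ σ³e^{Λ′(s−s₀)}`, `Λ′ := max(Λ, g) + 0`, exit at `s_e − s₀ = (3/Λ′)log(1/σ) − O(1)`; C¹-continuation (`LWP`)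
keeps the solution classical while the bootstrap norms are finite; return to physical variables (CGSS p. 41):
`ρ(t_e, x⋆) ≥ (S(0)/6r)³(T−t_e)^{−β} ≥ σ^{−κ₀}` for any `κ₀ < 3g/Λ′` and `σ` small. Honest residual: the finite-horizon
non-decaying variant of Prop 3.3 and the 3-field forcing estimate are not in print (card falsifiers (2)–(3)). -/
def ForcedFiniteHorizonBootstrap : Prop :=
  HsEosLowDensity → LWP → ∀ (r : ℝ) (U S : ℝ → ℝ), AdmissibleProfile r U S → ShadowsUntilCompression r U S

/-- STUB 4 (statics; size M): **quantitative smooth local-Gibbs statics with the IDENTIFIED LLN density** — the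
tree's explicit cluster series `rhoLim (profileOf a₀) σ = Σ_j γ_{j+1} R^{j+1} a₀^{j+1} = G_σ ∘ a₀` (`HardSphereEulerLLN`).
For a smooth positive activity `a₀` with `∫a₀ = 1` (so `β = a₀`; the canonical local Gibbs law is invariant under
`a₀ ↦ c·a₀`), continuous `u₀`, `θ₀ > 0` and every order `m`, for all small `σ`: `rhoLim (profileOf a₀) σ` is smooth and
positive, `‖rhoLim − a₀‖_{C^m} ≤ Mσ³` (all derivatives of the periodic lift up to order `m`), and the local Gibbs
empirical fields at `t = 0` satisfy the LLN towards `(rhoLim, u₀, θ₀)` for EVERY flow family. STATUS: the LLN with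
this density and the `k = 0` rate are PROVED in the standing `Disproof.lean` (cycle 2: `lln_rhoLim`,
`densityLLN_rhoLim`, `abs_rhoLim_sub_β_le : |rhoLim − β| ≤ 16e²v₁M²σ³`, `abs_ratioLimit_sub_one_le`, positivity via
`SmallDensity.rhoLim_pos`); what remains is smoothness + the `C^m` rate: `G_σ(b) = Σ_j γ_{j+1}R^{j+1}b^{j+1}`,
`|γ_{j+1}R^{j+1}| ≤ 2e(2ev₁σ³)ʲ` (`abs_clusterCoeff_le`, `R ≤ 2`), radius `→ ∞`, so `‖G_σ − R·id‖_{C^m[0,M]} = O_m(σ³)`,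
then Faà di Bruno through `a₀` (Disproof §8, input I2: "routine, not yet written"). -/
def SmoothLocalGibbsStatics : Prop :=
  ∀ (a₀ : T3 → ℝ) (ha : Torus.IsSmooth a₀) (ha0 : ∀ x, 0 < a₀ x) (u₀ : T3 → V3) (θ₀ : T3 → ℝ),
    Continuous u₀ → Continuous θ₀ → (∀ x, 0 < θ₀ x) → ∫ x, a₀ x = 1 → ∀ m : ℕ,
    ∃ M : ℝ, 0 < M ∧ ∃ σ₁ : ℝ, 0 < σ₁ ∧ ∀ σ : ℝ, 0 < σ → σ < σ₁ →
      Torus.IsSmooth (rhoLim (profileOf a₀ ha.continuous ha0) σ) ∧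
      (∀ x, 0 < rhoLim (profileOf a₀ ha.continuous ha0) σ x) ∧
      (∀ k : ℕ, k ≤ m → ∀ y : E3,
        ‖iteratedFDeriv ℝ k (Torus.lift (fun x => rhoLim (profileOf a₀ ha.continuous ha0) σ x - a₀ x)) y‖ ≤
          M * σ ^ 3) ∧
      ∀ Φ : (N : ℕ) → HardSphereFlow (Literature.Analysis.FluidPDE.Torus.geometry (Fin 3)) (hsDiameter σ N) (N + 1),
        TendstoHydroFieldsAt (fun N => localGibbsLaw σ a₀ u₀ θ₀ N (Φ N)) Φ
          (fun _ => rhoLim (profileOf a₀ ha.continuous ha0) σ) (fun _ => u₀) (fun _ => θ₀) 0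

/-! ## Registered stubs (`ledger skeleton check … --crux stmt-AtomisticToContinuum-12587`) -/

/-- STUB 1: BCG Thm 1.1 (γ = 5/3) + CGSS (1.5)–(1.10), Lemma 4.1. -/
theorem stub_selfSimilarProfile : SelfSimilarProfile := by
  sorry

/-- STUB 2: Kato/Majda local well-posedness + C¹ continuation for the 5×5 hard-sphere system, EOS analytic. -/
theorem stub_localWellPosedness : LocalWellPosedness := by
  sorry

/-- STUB 3 (load-bearing): forced finite-horizon self-similar bootstrap, EOS defect in the `𝓕_dis` slot. -/
theorem stub_forcedFiniteHorizonBootstrap : ForcedFiniteHorizonBootstrap := by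
  sorry

/-- STUB 4: smoothness and `C^m` rate `σ³` of the identified LLN density `rhoLim (profileOf a₀) σ`, plus its LLN
(the LLN and the `k = 0` rate are already proved in `Disproof.lean` §2–§3). -/
theorem stub_smoothLocalGibbsStatics : SmoothLocalGibbsStatics := by
  sorry

/-! ## Glue (proved, no sorry) -/

/-- The `t = 0` LLN clause only sees the time-zero slices of the fields (cf. Disproof.lean §1
`tendstoHydroFieldsAt_zero_iff`). -/
theorem tendstoHydroFieldsAt_zero_congr {ε : ℕ → ℝ}
    (P : (N : ℕ) → Measure (Literature.Analysis.FluidPDE.Config (N + 1) (Fin 3) T3))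
    (Φ : (N : ℕ) → HardSphereFlow (Literature.Analysis.FluidPDE.Torus.geometry (Fin 3)) (ε N) (N + 1))
    {ρ ρ' θ θ' : ℝ → T3 → ℝ} {u u' : ℝ → T3 → V3}
    (hρ : ρ 0 = ρ' 0) (hu : u 0 = u' 0) (hθ : θ 0 = θ' 0) :
    TendstoHydroFieldsAt P Φ ρ u θ 0 ↔ TendstoHydroFieldsAt P Φ ρ' u' θ' 0 := by
  unfold TendstoHydroFieldsAt
  rw [hρ, hu, hθ]

/-- The TRANSFER TARGET C⁺ of the idea card, σ-uniform polynomial compression: as the crux, but for ALL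
`σ < σ₁` instead of along a sequence (PROVED from the stubs below: `uniform_of_stubs`). -/
def PolynomialCompressionUniform : Prop :=
  ∃ κ : ℝ, 0 < κ ∧ ∃ (a₀ θ₀ : T3 → ℝ) (u₀ : T3 → V3), Continuous a₀ ∧ Continuous θ₀ ∧ Continuous u₀ ∧
    (∀ x, 0 < a₀ x) ∧ (∀ x, 0 < θ₀ x) ∧ ∃ σ₁ : ℝ, 0 < σ₁ ∧ ∀ σ : ℝ, 0 < σ → σ < σ₁ →
      ∃ (T : ℝ) (ρ θ : ℝ → T3 → ℝ) (u : ℝ → T3 → V3), IsHardSphereEulerSolution σ T ρ u θ ∧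
        (∀ Φ : (N : ℕ) → HardSphereFlow (Literature.Analysis.FluidPDE.Torus.geometry (Fin 3)) (hsDiameter σ N) (N + 1),
          TendstoHydroFieldsAt (fun N => localGibbsLaw σ a₀ u₀ θ₀ N (Φ N)) Φ ρ u θ 0) ∧
        ∃ t ∈ Ico 0 T, ∃ x, σ ^ (-κ) ≤ ρ t x

/-- **C⁺ from the stubs (proved).** κ := κ₀ of the bootstrap stub; profiles := its glued reference data
`(ρ̄₀, (3/5)ρ̄₀^{2/3}, u₀)`; σ₁ := min of the statics and bootstrap thresholds; for `σ < σ₁` the datum is the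
identified LLN density `ρσ`, `Mσ³`-close to `ρ̄₀` in `C^m`, the bootstrap stub launches the classical solution and
gives `σ^{−κ₀} ≤ ρ t x⋆`, and admissibility is the statics LLN transported along `ρ 0 = ρσ`, `u 0 = u₀`, `θ 0 = θ₀`. -/
theorem uniform_of_stubs (hEos : HsEosLowDensity) (hP : SelfSimilarProfile) (hL : LocalWellPosedness)
    (hB : ForcedFiniteHorizonBootstrap) (hS : SmoothLocalGibbsStatics) : PolynomialCompressionUniform := by
  obtain ⟨r, U, S, hprof⟩ := hP
  obtain ⟨ρb, u₀, xc, T, ϱ, m, κ₀, -, -, hκ₀, hρb, hu₀, hρb_pos, hmass, -, hmain⟩ :=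
    hB hEos (hL hEos) r U S hprof
  set θ₀ : T3 → ℝ := fun x => 3 / 5 * ρb x ^ (2 / 3 : ℝ) with hθ₀def
  have hθ₀_pos : ∀ x, 0 < θ₀ x := fun x =>
    mul_pos (by norm_num) (Real.rpow_pos_of_pos (hρb_pos x) _)
  have hρb_cont : Continuous ρb := hρb.continuous
  have hu₀_cont : Continuous u₀ := hu₀.continuous
  have hθ₀_cont : Continuous θ₀ :=
    continuous_const.mul (hρb_cont.rpow_const fun x => Or.inr (by norm_num))
  obtain ⟨M, hM, σ₂, hσ₂, hstat⟩ :=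
    hS ρb hρb hρb_pos u₀ θ₀ hu₀_cont hθ₀_cont hθ₀_pos hmass m
  obtain ⟨σ₁, hσ₁, htrack⟩ := hmain M hM
  refine ⟨κ₀, hκ₀, ρb, θ₀, u₀, hρb_cont, hθ₀_cont, hu₀_cont, hρb_pos, hθ₀_pos,
    min σ₁ σ₂, lt_min hσ₁ hσ₂, ?_⟩
  intro σ hσpos hσlt
  have hσσ₁ : σ < σ₁ := hσlt.trans_le (min_le_left _ _)
  have hσσ₂ : σ < σ₂ := hσlt.trans_le (min_le_right _ _)
  obtain ⟨hρσ_smooth, hρσ_pos, hclose, hLLN⟩ := hstat σ hσpos hσσ₂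
  set ρσ : T3 → ℝ := rhoLim (profileOf ρb hρb.continuous hρb_pos) σ with hρσdef
  obtain ⟨Te, ρ, θ, u, hsol, hρ0, hu0, hθ0, t, ht, -, -, hdens⟩ :=
    htrack σ hσpos hσσ₁ ρσ hρσ_smooth hρσ_pos hclose
  refine ⟨Te, ρ, θ, u, hsol, fun Φ => ?_, t, ht, xc, hdens⟩
  have hρ0' : ρ 0 = (fun _ : ℝ => ρσ) 0 := hρ0
  have hu0' : u 0 = (fun _ : ℝ => u₀) 0 := hu0
  have hθ0' : θ 0 = (fun _ : ℝ => θ₀) 0 := hθ0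
  exact (tendstoHydroFieldsAt_zero_congr _ Φ hρ0' hu0' hθ0').2 (hLLN Φ)

/-- **Composition (kernel-checked; no sorry in this proof).** The four registered stubs and the route's support item
`HsEosLowDensity` (stmt-0768, the only hypothesis, admissible BY NAME) give the crux
`ImplosionDichotomy.PolynomialCompression` BY NAME, through C⁺ (`uniform_of_stubs`): for `σ₀ > 0` take `σ := min σ₀ σ₁ / 2`.
Logical shape: `HsEosLowDensity → SelfSimilarProfile → LocalWellPosedness → ForcedFiniteHorizonBootstrap →
SmoothLocalGibbsStatics → PolynomialCompression`, the middle four discharged by `stub_*`. -/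
theorem PolynomialCompression_of (hEos : HsEosLowDensity) : PolynomialCompression := by
  obtain ⟨κ, hκ, a₀, θ₀, u₀, ha, hθ, hu, ha0, hθ0, σ₁, hσ₁, hall⟩ :=
    uniform_of_stubs hEos stub_selfSimilarProfile stub_localWellPosedness stub_forcedFiniteHorizonBootstrap
      stub_smoothLocalGibbsStatics
  refine ⟨κ, hκ, a₀, θ₀, u₀, ha, hθ, hu, ha0, hθ0, fun σ₀ hσ₀ => ?_⟩
  have hmpos : 0 < min σ₀ σ₁ := lt_min hσ₀ hσ₁
  have hlt : min σ₀ σ₁ / 2 < min σ₀ σ₁ := half_lt_self hmpos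
  obtain ⟨T, ρ, θ, u, hsol, hadm, hcomp⟩ :=
    hall (min σ₀ σ₁ / 2) (half_pos hmpos) (hlt.trans_le (min_le_right _ _))
  exact ⟨min σ₀ σ₁ / 2, half_pos hmpos, hlt.trans_le (min_le_left _ _), T, ρ, θ, u, hsol, hadm, hcomp⟩

end Summit.AtomisticToContinuum.HydrodynamicLimit.Cruxes.PolynomialCompression.EosDefectAsForcing

end
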